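import Summits.ResolutionOfSingularities.ResolutionOfSingularities.Theorems.UniversalCellsCampaignW82DiagonalCriterion
import Literature.AlgebraicGeometry.Resolution.SmoothStalksRegular
import Literature.AlgebraicGeometry.Resolution.AlterationsProofs
import Literature.AlgebraicGeometry.Resolution.ProjectiveSpaceRegular
import Mathlib.AlgebraicGeometry.Morphisms.Smooth
import HarnessLib

/-!
# [OURS · L1 W8.2] THE DIAGONAL (SELF-PRODUCT) CRITERION, scheme form: a scheme `Y` locally of finite type over ANY
# field `K` is smooth over `K` iff `Y ×_K Y` is a regular scheme

Cell `res-hironaka` (run/shared/lean/pub/res-hironaka/), LADDER-RESOLUTION rung L (RESCUE), slot W8.2; host route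
`UniversalCells`, host item `PrimeFieldToPerfect` (stmt-ResolutionOfSingularities-15233), door 1. Proofs file
(Theses-free), written by res-L1-s82-pv-1 (gen 6). Scheme-level form of (E5) of Cruxes/PrimeFieldToPerfect/KERNEL.md
§2, from the affine criterion `smooth_iff_isRegularRing_tensor_self` (`…DiagonalCriterion.lean`):

* `isRegular_pullback_self_of_smooth` — `q : Y ⟶ Spec K` smooth ⇒ `Y ×_K Y` is a regular scheme (it is smooth
  over `K`; Stacks 056S, tree `isRegularLocalRing_stalk_of_smooth_of_field`).
* `isRegularRing_tensor_of_isRegular_pullback_self` — for an affine open `U ⊆ Y` with `A = Γ(Y, U)` (a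
  `K`-algebra through the chart `Spec A ⟶ Y ⟶ Spec K`): `Y ×_K Y` regular ⇒ `A ⊗_K A` a regular ring
  (`Spec (A ⊗_K A) ≅ Spec A ×_K Spec A ↪ Y ×_K Y` is an open immersion, Mathlib `pullbackSpecIso` / `pullback.map`).
* **`smooth_of_isRegular_pullback_self`**, **`smooth_iff_isRegular_pullback_self`** — for `q` locally of finite
  type: `Smooth q ↔ Scheme.IsRegular (pullback q q)` (smoothness is Zariski-local on the source; on an affine chart
  it is `Algebra.Smooth K A`, i.e. `A ⊗_K A` regular by the affine criterion).

READING for slot W8.2: in every normal form of the residual («some Frobenius twist of `X₀` has a SMOOTH proper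
birational model `Y` over `M(t)`», and the kernel `SmoothTwist` over finitely generated `K` of any `p`-rank) the
word SMOOTH may be replaced by «`Y ×_K Y` REGULAR» — a condition on regular schemes only, with no hypothesis on
the ground field (links leaf `…DiagonalCriterionLinks`).

HONEST FRAMING. OURS theorems (classical algebraic geometry assembled from the tree and Mathlib); they replace the
role of no printed item of [Hironaka2017] and are NOT statements of the manuscript; nothing is attributed to its
author. A normal form, not progress on the open residual. AI work, weaker than expert review; no claim beyond the
kernel. No `sorry`, no new axioms.

## References (locators only)
* A. Grothendieck, *EGA IV₄*, Publ. Math. IHÉS 32 (1967), 17.12.3–17.12.5.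
* The Stacks Project, Tags 056S, 00TV, 02IS. [StacksProject]
-/

noncomputable section

set_option linter.dupNamespace false -- mandated namespace of this single-conjunct summit

open CategoryTheory CategoryTheory.Limits AlgebraicGeometry TopologicalSpace TensorProduct
open Literature.AlgebraicGeometry.Resolution

namespace Summit.ResolutionOfSingularities.ResolutionOfSingularities.Theorems.CampaignW82

universe u

variable {K : Type u} [Field K] {Y : Scheme.{u}} (q : Y ⟶ Spec (.of K))

/-! ## Smooth ⇒ the self-product is regular -/

/-- **`Y` smooth over `K` ⇒ `Y ×_K Y` regular**: the self-product is smooth over `K` (base change and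
composition), and a scheme smooth over a field is regular (Stacks 056S). [cite: StacksProject, Tag 056S] -/
theorem isRegular_pullback_self_of_smooth [Smooth q] : Scheme.IsRegular (pullback q q) := by
  haveI : Smooth (pullback.fst q q) := MorphismProperty.pullback_fst _ _ ‹Smooth q›
  haveI : Smooth (pullback.fst q q ≫ q) := inferInstance
  exact fun x => isRegularLocalRing_stalk_of_smooth_of_field (pullback.fst q q ≫ q) x

/-! ## An affine chart of `Y` and the corresponding affine chart `Spec (A ⊗_K A)` of `Y ×_K Y` -/

/-- **Regularity of `Y ×_K Y` gives regularity of `A ⊗_K A` on affine charts.** Let `U ⊆ Y` be an affine open,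
`A = Γ(Y, U)`, made a `K`-algebra by a ring map `φ : K → A` with `Spec φ = (Spec A ≅ U ↪ Y) ≫ q`. If `Y ×_K Y` is a
regular scheme then `A ⊗_K A` is a regular ring: `Spec (A ⊗_K A) ≅ Spec A ×_K Spec A → Y ×_K Y` is an open
immersion. [folklore] -/
theorem isRegularRing_tensor_of_isRegular_pullback_self {U : Y.Opens} (hU : IsAffineOpen U)
    [Algebra K Γ(Y, U)] [Algebra.FiniteType K Γ(Y, U)]
    (hφ : Spec.map (CommRingCat.ofHom (algebraMap K Γ(Y, U))) = hU.fromSpec ≫ q)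
    (hW : Scheme.IsRegular (pullback q q)) : IsRegularRing (Γ(Y, U) ⊗[K] Γ(Y, U)) := by
  -- the open immersion `Spec A ×_K Spec A → Y ×_K Y`, `A = Γ(Y, U)`
  let j := pullback.map (Spec.map (CommRingCat.ofHom (algebraMap K Γ(Y, U))))
    (Spec.map (CommRingCat.ofHom (algebraMap K Γ(Y, U)))) q q hU.fromSpec hU.fromSpec (𝟙 _)
    ((Category.comp_id _).trans hφ) ((Category.comp_id _).trans hφ)
  haveI hj : IsOpenImmersion j :=
    MorphismProperty.pullbackMap (P := @IsOpenImmersion) (inferInstance : IsOpenImmersion hU.fromSpec)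
      (inferInstance : IsOpenImmersion hU.fromSpec) hφ hφ
  have h1 : Scheme.IsRegular (pullback (Spec.map (CommRingCat.ofHom (algebraMap K Γ(Y, U))))
      (Spec.map (CommRingCat.ofHom (algebraMap K Γ(Y, U))))) :=
    Scheme.IsRegular.of_isOpenImmersion j hW
  have h2 : Scheme.IsRegular (Spec (.of (Γ(Y, U) ⊗[K] Γ(Y, U)))) :=
    Scheme.IsRegular.of_isOpenImmersion (pullbackSpecIso K Γ(Y, U) Γ(Y, U)).inv h1
  haveI : Algebra.FiniteType K (Γ(Y, U) ⊗[K] Γ(Y, U)) :=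
    Algebra.FiniteType.trans (R := K) (S := Γ(Y, U)) inferInstance inferInstance
  haveI : IsNoetherianRing (Γ(Y, U) ⊗[K] Γ(Y, U)) := Algebra.FiniteType.isNoetherianRing K _
  exact (Scheme.isRegular_Spec_iff (.of (Γ(Y, U) ⊗[K] Γ(Y, U)))).mp h2

/-! ## The self-product regular ⇒ smooth -/

/-- **`Y ×_K Y` regular ⇒ `Y` smooth over `K`** (`q` locally of finite type): smoothness is Zariski-local on `Y`;
on an affine chart `Spec A ⟶ Y ⟶ Spec K` it is `Algebra.Smooth K A`, which by the affine criterion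
`smooth_iff_isRegularRing_tensor_self` is the regularity of `A ⊗_K A`, an open piece of `Y ×_K Y`. [folklore] -/
theorem smooth_of_isRegular_pullback_self [LocallyOfFiniteType q] (hW : Scheme.IsRegular (pullback q q)) :
    Smooth q := by
  refine IsZariskiLocalAtSource.of_iSup_eq_top (P := @Smooth) (fun U : Y.affineOpens => (U : Y.Opens))
    (iSup_affineOpens_eq_top Y) fun U => ?_
  have hU : IsAffineOpen (U : Y.Opens) := U.2
  -- the chart `φ : K → A = Γ(Y, U)` with `Spec φ = fromSpec ≫ q`
  let φ : CommRingCat.of K ⟶ Γ(Y, U) := Spec.preimage (hU.fromSpec ≫ q)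
  have hSpec : Spec.map φ = hU.fromSpec ≫ q := Spec.map_preimage _
  have hft : φ.hom.FiniteType := by
    have : LocallyOfFiniteType (Spec.map φ) := by rw [hSpec]; infer_instance
    exact (HasRingHomProperty.Spec_iff (P := @LocallyOfFiniteType)).mp this
  algebraize [φ.hom]
  have hφ : Spec.map (CommRingCat.ofHom (algebraMap K Γ(Y, U))) = hU.fromSpec ≫ q := by
    rw [← hSpec]
    rfl
  have hreg : IsRegularRing (Γ(Y, U) ⊗[K] Γ(Y, U)) :=
    isRegularRing_tensor_of_isRegular_pullback_self q hU hφ hW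
  have hsmA : Algebra.Smooth K Γ(Y, U) := (smooth_iff_isRegularRing_tensor_self K Γ(Y, U)).mpr hreg
  have hsm : Smooth (Spec.map φ) := by
    rw [HasRingHomProperty.Spec_iff (P := @Smooth)]
    exact RingHom.smooth_algebraMap.mpr hsmA
  rw [hSpec, ← IsAffineOpen.isoSpec_inv_ι, Category.assoc] at hsm
  exact (MorphismProperty.cancel_left_of_respectsIso @Smooth _ _).mp hsm

/-- **THE DIAGONAL (SELF-PRODUCT) CRITERION OF SMOOTHNESS, scheme form**: for `q : Y ⟶ Spec K` locally of finite
type over ANY field `K`, `q` is smooth iff `Y ×_K Y` is a regular scheme. [folklore] -/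
theorem smooth_iff_isRegular_pullback_self [LocallyOfFiniteType q] :
    Smooth q ↔ Scheme.IsRegular (pullback q q) :=
  ⟨fun _ => isRegular_pullback_self_of_smooth q, smooth_of_isRegular_pullback_self q⟩

end Summit.ResolutionOfSingularities.ResolutionOfSingularities.Theorems.CampaignW82

end
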